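import Mathlib
import Summits.AtomisticToContinuum.Crystallization.Theses.PhononSlackCertificates
import Summits.AtomisticToContinuum.Crystallization.Theorems.PhononSlackCertificatesNearFarGlueRAssembly
import Summits.AtomisticToContinuum.Crystallization.Theorems.NearFarGlueR.Negative.PointwiseContactGap
import Literature.MathematicalPhysics.StatisticalMechanics.LennardJonesClusters

/-!
# Crux `PhononSlackCertificates.NearFarGlueR` (stmt-AtomisticToContinuum-14970), line `Sketch`:
the EXTREME-LAYER species — every finite configuration pays for its top layer in every direction

Continuation lead c5.  The mirror principle (`mirror_principle`,
`Theorems/PhononSlackCertificatesNearFarGlueRAssembly.lean`) needs a supporting plane with all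
particles at signed distance `≥ 9/20` on one side.  For the EXTREME layer of a finite
configuration in a direction `n` this hypothesis is automatic: reflect in the plane
`⟪p, n⟫ = M + 9/20`, `M ≥ max_i ⟪x_i, n⟫`.  With the monotonicity of `V_LJ` (decreasing on
`(0, 1]`, increasing on `[1, ∞)`, so `V(r) ≤ V(2D)` for `9/10 ≤ r ≤ 2D`, `2D ≥ 3/2`) this gives
the hypothesis-free species

* `extremeLayer_gap` (= registered sub-goal `stub_extremeLayer`): for EVERY finite injective
  configuration `x` of `ℝ³`, every unit vector `n`, every `M ≥ max_i ⟪x_i, n⟫` and every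
  `D ≥ 3/4`:  `N·e* + ½(−V(2D))·#{i : ⟪x_i, n⟫ ≥ M + 9/20 − D} ≤ 𝓔_LJ(x)`.
  At `D = 3/4`: the particles within `3/10` of the top in ANY direction pay `½(−V(3/2)) ≈ 0.0070 ≥ 1/150`
  each; at `D = 1`: within `11/20` of the top, `½(−V(2)) ≈ 0.0013` each.  No separation, no
  goodness, no lattice, no cone on `e*`.

In the residual's currency: the tight contacts of the extreme layers are priced in every finite
configuration whatsoever (`tightContact_ineq_extremeLayer`).  All `[folklore]`.
-/

noncomputable section

namespace Summit.AtomisticToContinuum.Crystallization.Theorems.PhononSlackCertificatesNearFarGlueR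

open Literature.MathematicalPhysics.StatisticalMechanics
open Literature.Geometry.DiscreteGeometry
open Summit.AtomisticToContinuum.Crystallization.Theses.PhononSlackCertificates
open scoped BigOperators RealInnerProductSpace

/-! ## §1 Monotonicity of the Lennard-Jones potential

(`V_LJ` increasing on `[1, ∞)` is `NearFarGlueRNegative.lennardJones_mono_of_one_le`,
`Theorems/NearFarGlueR/Negative/PointwiseContactGap.lean`.) -/

/-- `V_LJ` is decreasing on `(0, 1]`: for `0 < r ≤ t ≤ 1`, `V(t) ≤ V(r)`. [folklore] -/
theorem lennardJones_le_of_le_one {r t : ℝ} (hr : 0 < r) (hrt : r ≤ t) (ht : t ≤ 1) :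
    lennardJones t ≤ lennardJones r := by
  unfold lennardJones
  have ht0 : 0 < t := by linarith
  set a : ℝ := (r⁻¹) ^ 6 with ha
  set b : ℝ := (t⁻¹) ^ 6 with hb
  have hb1 : 1 ≤ b := by
    rw [hb]; exact one_le_pow₀ ((one_le_inv₀ ht0).2 ht)
  have hba : b ≤ a := pow_le_pow_left₀ (inv_nonneg.2 ht0.le) (inv_anti₀ hr hrt) 6
  have h12r : (r⁻¹) ^ 12 = a ^ 2 := by rw [ha]; ring
  have h12t : (t⁻¹) ^ 12 = b ^ 2 := by rw [hb]; ring
  rw [h12r, h12t]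
  nlinarith [mul_nonneg (sub_nonneg.2 hba) (by linarith : (0 : ℝ) ≤ a + b - 2)]

/-- `V_LJ(9/10) ≤ V_LJ(3/2)` (`−0.0186 ≤ −0.0140`). [folklore] -/
theorem lennardJones_nine_tenths_le_three_halves :
    lennardJones (9 / 10) ≤ lennardJones (3 / 2) := by
  unfold lennardJones
  norm_num

/-- On `[9/10, 2D]` with `2D ≥ 3/2` the potential is at most its value at the far end:
`V(r) ≤ V(2D)`. [folklore] -/
theorem lennardJones_le_far_end {r D : ℝ} (h1 : 9 / 10 ≤ r) (h2 : r ≤ 2 * D) (hD : 3 / 4 ≤ D) :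
    lennardJones r ≤ lennardJones (2 * D) := by
  rcases le_or_gt 1 r with hr | hr
  · exact NearFarGlueRNegative.lennardJones_mono_of_one_le hr h2
  · calc lennardJones r ≤ lennardJones (9 / 10) :=
          lennardJones_le_of_le_one (by norm_num) h1 hr.le
      _ ≤ lennardJones (3 / 2) := lennardJones_nine_tenths_le_three_halves
      _ ≤ lennardJones (2 * D) :=
          NearFarGlueRNegative.lennardJones_mono_of_one_le (by norm_num) (by linarith)

/-! ## §2 The extreme layer pays -/

open scoped Classical in
/-- **Extreme-layer species.**  For every finite injective configuration `x` of `ℝ³`, every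
unit vector `n`, every `M` with `⟪x_i, n⟫ ≤ M` for all `i`, and every `D ≥ 3/4`:
`N·e* + ½(−V(2D))·#{i : M + 9/20 − D ≤ ⟪x_i, n⟫} ≤ 𝓔_LJ(x)` — the mirror principle for the
plane `⟪p, n⟫ = M + 9/20` (normal `−n`), every particle paying `½(−V(2 s_i)) ≥ 0` and those
with `s_i ≤ D` at least `½(−V(2D))`. [folklore] -/
theorem extremeLayer_gap {N : ℕ} (x : Fin N → EuclideanSpace ℝ (Fin 3))
    (hx : Function.Injective x) {n : EuclideanSpace ℝ (Fin 3)} (hn : ‖n‖ = 1) {M D : ℝ}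
    (hM : ∀ i : Fin N, ⟪x i, n⟫ ≤ M) (hD : 3 / 4 ≤ D) :
    (N : ℝ) * (⨅ Q : PeriodicConfiguration 3, Q.energyPerParticle lennardJones) +
      (1 / 2 : ℝ) * (-lennardJones (2 * D)) *
        (Nat.card {i : Fin N // M + 9 / 20 - D ≤ ⟪x i, n⟫} : ℝ)
        ≤ interactionEnergy lennardJones x := by
  -- mirror principle for the plane `⟪p, -n⟫ = -(M + 9/20)`
  have hn' : ‖-n‖ = 1 := by rw [norm_neg, hn]
  have hside : ∀ i : Fin N, (9 / 20 : ℝ) ≤ ⟪x i, -n⟫ - (-(M + 9 / 20)) := fun i => by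
    rw [inner_neg_right]; linarith [hM i]
  have hP := mirror_principle x hx hn' (-(M + 9 / 20)) hside
  simp only [inner_neg_right] at hP
  -- every term pays `≥ 0`, the layer terms pay `≥ -V(2D)`
  set S := Finset.univ.filter fun i : Fin N => M + 9 / 20 - D ≤ ⟪x i, n⟫ with hS
  have hcard : (Nat.card {i : Fin N // M + 9 / 20 - D ≤ ⟪x i, n⟫} : ℝ) = S.card := by
    rw [Nat.card_eq_fintype_card, Fintype.card_subtype, hS]
  have hsplit := Finset.sum_filter_add_sum_filter_not Finset.univ
    (fun i : Fin N => M + 9 / 20 - D ≤ ⟪x i, n⟫)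
    (fun i => lennardJones (2 * (-⟪x i, n⟫ - -(M + 9 / 20))))
  have hin : ∑ i ∈ S, lennardJones (2 * (-⟪x i, n⟫ - -(M + 9 / 20))) ≤
      ∑ i ∈ S, lennardJones (2 * D) :=
    Finset.sum_le_sum fun i hi => by
      have hi' := (Finset.mem_filter.1 hi).2
      exact lennardJones_le_far_end (by linarith [hM i]) (by linarith) hD
  have hout : ∑ i ∈ Finset.univ.filter (fun i : Fin N => ¬ (M + 9 / 20 - D ≤ ⟪x i, n⟫)),
      lennardJones (2 * (-⟪x i, n⟫ - -(M + 9 / 20))) ≤ 0 :=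
    Finset.sum_nonpos fun i _ => lennardJones_nonpos_of_ge_nine_tenths (by linarith [hM i])
  rw [Finset.sum_const, nsmul_eq_mul] at hin
  rw [← hS] at hsplit
  rw [hcard]
  linarith

/-- **Registered sub-goal `stub_extremeLayer` of the line `Sketch`** (the extreme-layer species
in closed form, `inner ℝ (x i) n` written out). [folklore] -/
theorem stub_extremeLayer :
    ∀ (N : ℕ) (x : Fin N → EuclideanSpace ℝ (Fin 3)), Function.Injective x →
    ∀ (n : EuclideanSpace ℝ (Fin 3)), ‖n‖ = 1 → ∀ (M D : ℝ),
      (∀ i : Fin N, inner ℝ (x i) n ≤ M) → 3 / 4 ≤ D →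
      (N : ℝ) * (⨅ Q : PeriodicConfiguration 3, Q.energyPerParticle lennardJones) +
        (1 / 2 : ℝ) * (-lennardJones (2 * D)) *
          (Nat.card {i : Fin N // M + 9 / 20 - D ≤ inner ℝ (x i) n} : ℝ)
        ≤ interactionEnergy lennardJones x :=
  fun _ x hx _ hn _ _ hM hD => extremeLayer_gap x hx hn hM hD

/-- `½(−V(3/2)) ≥ 1/150` (`½·0.01399 = 0.00699`): the quantum of the `3/10`-thick extreme layer.
[folklore] -/
theorem one_div_le_half_neg_lennardJones_three_halves :
    (1 / 150 : ℝ) ≤ (1 / 2 : ℝ) * (-lennardJones (2 * (3 / 4))) := by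
  unfold lennardJones
  norm_num

open scoped Classical in
/-- **The extreme layers pay `1/150` per particle**: for every finite injective `x`, every unit
`n` and every `M ≥ max_i ⟪x_i, n⟫`, `N·e* + (1/150)·#{i : M − 3/10 ≤ ⟪x_i, n⟫} ≤ 𝓔_LJ(x)`.
[folklore] -/
theorem extremeLayer_gap_three_tenths {N : ℕ} (x : Fin N → EuclideanSpace ℝ (Fin 3))
    (hx : Function.Injective x) {n : EuclideanSpace ℝ (Fin 3)} (hn : ‖n‖ = 1) {M : ℝ}
    (hM : ∀ i : Fin N, ⟪x i, n⟫ ≤ M) :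
    (N : ℝ) * (⨅ Q : PeriodicConfiguration 3, Q.energyPerParticle lennardJones) +
      (1 / 150 : ℝ) * (Nat.card {i : Fin N // M - 3 / 10 ≤ ⟪x i, n⟫} : ℝ)
        ≤ interactionEnergy lennardJones x := by
  have h := extremeLayer_gap x hx hn hM (le_refl (3 / 4 : ℝ))
  have he : ∀ i : Fin N, (M + 9 / 20 - 3 / 4 ≤ ⟪x i, n⟫) ↔ (M - 3 / 10 ≤ ⟪x i, n⟫) := fun i => by
    constructor <;> intro hi <;> linarith
  have hcard : (Nat.card {i : Fin N // M + 9 / 20 - 3 / 4 ≤ ⟪x i, n⟫} : ℝ) =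
      (Nat.card {i : Fin N // M - 3 / 10 ≤ ⟪x i, n⟫} : ℝ) := by
    rw [Nat.card_eq_fintype_card, Nat.card_eq_fintype_card, Fintype.card_subtype,
      Fintype.card_subtype]
    congr 2
    exact Finset.filter_congr fun i _ => he i
  rw [hcard] at h
  have hc : (0 : ℝ) ≤ (Nat.card {i : Fin N // M - 3 / 10 ≤ ⟪x i, n⟫} : ℝ) := by positivity
  nlinarith [one_div_le_half_neg_lennardJones_three_halves, hc]

open scoped Classical in
/-- **The extreme-layer species in the residual's currency**: in every finite injective
configuration, the tight contacts of the `3/10`-thick extreme layer in any direction pay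
`1/150` each. [folklore] -/
theorem tightContact_ineq_extremeLayer {N : ℕ} (x : Fin N → EuclideanSpace ℝ (Fin 3))
    (hx : Function.Injective x) {n : EuclideanSpace ℝ (Fin 3)} (hn : ‖n‖ = 1) {M : ℝ}
    (hM : ∀ i : Fin N, ⟪x i, n⟫ ≤ M) :
    (N : ℝ) * (⨅ Q : PeriodicConfiguration 3, Q.energyPerParticle lennardJones) +
      (1 / 150 : ℝ) * (Nat.card {j : Fin N //
          (¬ IsTwoShellGood (1 / 20) (47 / 50) 1 x j ∧
            ∃ i : Fin N, IsTwoShellGood (1 / 20) (47 / 50) 1 x i ∧ dist (x i) (x j) ≤ 21 / 20) ∧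
          M - 3 / 10 ≤ ⟪x j, n⟫} : ℝ)
        ≤ interactionEnergy lennardJones x := by
  have h := extremeLayer_gap_three_tenths x hx hn hM
  have hle : Nat.card {j : Fin N //
          (¬ IsTwoShellGood (1 / 20) (47 / 50) 1 x j ∧
            ∃ i : Fin N, IsTwoShellGood (1 / 20) (47 / 50) 1 x i ∧ dist (x i) (x j) ≤ 21 / 20) ∧
          M - 3 / 10 ≤ ⟪x j, n⟫} ≤ Nat.card {i : Fin N // M - 3 / 10 ≤ ⟪x i, n⟫} := by
    rw [Nat.card_eq_fintype_card, Nat.card_eq_fintype_card]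
    refine Fintype.card_le_of_injective (fun j => ⟨j.1, j.2.2⟩) fun a b hab => ?_
    exact Subtype.ext (by simpa using congrArg (fun z : {i : Fin N // M - 3 / 10 ≤ ⟪x i, n⟫} => z.1) hab)
  have hcast : (Nat.card {j : Fin N //
          (¬ IsTwoShellGood (1 / 20) (47 / 50) 1 x j ∧
            ∃ i : Fin N, IsTwoShellGood (1 / 20) (47 / 50) 1 x i ∧ dist (x i) (x j) ≤ 21 / 20) ∧
          M - 3 / 10 ≤ ⟪x j, n⟫} : ℝ) ≤ (Nat.card {i : Fin N // M - 3 / 10 ≤ ⟪x i, n⟫} : ℝ) := by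
    exact_mod_cast hle
  nlinarith

end Summit.AtomisticToContinuum.Crystallization.Theorems.PhononSlackCertificatesNearFarGlueR

end
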